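import Literature.AnabelianGeometry.EtaleTheta.Discharge.Sec5Prop53UniversalClosureRefuted
import Literature.AnabelianGeometry.EtaleTheta.Discharge.Sec5Prop53ChainModel
import HarnessLib

/-!
# [EtTh] Proposition 5.3 (iv): the universal closure of `PreservesCspToNcsp` over the abstract §5 interface is
# FALSE — UNCONDITIONAL kernel countermodel at the in-tree toy datum (FACT-LIST row F-0560; R5 «named instances only»)

Mochizuki, *The étale theta function and its Frobenioid-theoretic manifestations*, Publ. RIMS **45** (2009), §5,
Proposition 5.3 (iv), p. 325 (PDF p. 99): `Ψ^Φ_{A_⊚}` preserves "the natural surjection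
`Prime(Φ(A_⊚))^csp ↠ Prime(Φ(A_⊚))^ncsp`" ("given by considering the irreducible component of the special fiber that
contains the cusp(s)") [cite: MochizukiEtTh2009, Prop 5.3 (iv) p.325 (PDF p.99)].
Cell abc-iut, block F (fact-proving wave), seat abc-iut-f-012 (gen 4, float on `plan/F-OPEN-UNCLAIMED.tsv`); FROZEN
FACT-LIST row **F-0560** (`FrobenioidThetaDivisors.PreservesCspToNcsp`, kernel_closedness = parametrised).
PROOF-ONLY companion of abc-iut-L2-t4's statement file `FrobenioidThetaDivisors.lean`: no `def`, no instance, no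
`sorry`, nothing landed is edited; abc-iut-f-009's toy datum (`Sec5Prop53Toy.lean`: `toyThetaDiv`, `toyPrimeData`,
`reindex`, `swapNcsp`; `Sec5Prop53UniversalClosureRefuted.lean`: `cuspPreserved_swapNcsp`, `swapNcsp_inr`, `P_ne`) and
abc-iut-f-128's chain model (`Sec5Prop53ChainModel.lean`: `preservesCspToNcsp_chain`) are used BY NAME.

WHY THIS FILE.  The sibling refutations of the universal closures of Prop. 5.3 (i) F-0561, (ii) F-0562, (iii) F-0559,
(v) F-0563, (vi) F-0564 and of the conjunction F-2497 (abc-iut-f-009) leave out (iv); abc-iut-f-004's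
`not_forall_preservesCspToNcsp_of_config` (`Sec5Prop53ivClosure.lean`) refutes the closure of (iv) over
`(𝔓, Ψ, ι, e, hc)` at every Θ-Frobenioid carrying a prime-permuting configuration, but constructs no such Θ-Frobenioid
("the full universal closure over `𝔉` is not itself decided").  The toy datum now in tree IS one, so the closure of
the row over ALL its binders `(C, D, 𝔉, 𝔓, Ψ, ι, e, hc)` is decided here — in the negative:

* `not_preservesCspToNcsp_toy` — at `toyThetaDiv` (`Φ(A_⊚) = ⊕_{ℤ ⊔ ℤ} ℚ_{≥0}`, cuspidal primes `P (inr n)`,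
  components `P (inl n)`, surjection `P (inr n) ↦ P (inl n)`), with `Ψ = 𝟭`, `ι = 𝟙` and
  `e = Ψ^Φ_{A_⊚} := reindex (inl 0 inl 1)` (which preserves cuspidality of primes: `hc = cuspPreserved_swapNcsp`),
  clause (iv) FAILS: the cusp `P (inr 0)` is FIXED while its component `P (inl 0)` is MOVED to `P (inl 1)`, so
  `cspToNcsp (Ψ^Φ 𝔞) = P (inl 0) ≠ P (inl 1) = Ψ^Φ (cspToNcsp 𝔞)`;
* **`not_forall_preservesCspToNcsp`** — hence the universal closure of the row (all binders, level 0) is FALSE;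
* `preservesCspToNcsp_schema_census` — the closure is false AND, by name, the instance form of record holds at the
  chain model for EVERY chain automorphism `e = (j ↦ εj + c)` (abc-iut-f-128 `Prop53Chain.preservesCspToNcsp_chain`);
  the interface-level instance forms are abc-iut-L2-d4's `preservesCspToNcsp_of_criterion`, abc-iut-L6-d1's
  `preservesCspToNcsp_of_criterion'` and abc-iut-f-127's `preservesCspToNcsp_of_orders` / `_of_invariant`.

CONSEQUENCE (plan/FACT-LIST.md R5): F-0560 is admissible AT NAMED INSTANCES ONLY; a hypothesis quantifying over all
`DivisorPrimeData` / all `e` is unsatisfiable.  What the witness exploits: `𝔓` (the surjection `cspToNcsp`) and `e` are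
FREE binders of OUR typing — print's `e` is the isomorphism of divisor monoids induced by `Ψ` through the geometry of
the special fibre, which a transposition of two components fixing all cusps is not.
HONEST FRAMING: a statement about the TYPED interface at a toy datum; it says nothing about the tempered Frobenioid of
[EtTh] §5, nothing about the truth of Prop. 5.3 there (a refereed, published result), and nothing about [IUTchIII]
Cor. 3.12; refuted-∀-closure ≠ refuted-paper; no side is taken; typed ≠ proved.
-/

namespace Literature.AnabelianGeometry.EtaleTheta

namespace FrobenioidThetaDivisors

namespace Prop53Toy

open CategoryTheory
open Literature.AlgebraicGeometry.Frobenioids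
open ConstantMultiple ConstantMultiple.Cor512Toy

/-! ### (iv) `PreservesCspToNcsp` fails at the toy datum for `e = reindex (inl 0 inl 1)` -/

/-- `label (P (inr n)) = n` (the cusp `P (inr n)` lies on the component with label `n`).
[cite: MochizukiEtTh2009, Prop 5.3 (iv) p.325 (PDF p.99)] -/
theorem label_P_inr (n : ℤ) : label (P (Sum.inr n)) = n := by
  simp [label, idx_P]

/-- `reindex (inl 0 inl 1)` FIXES the cuspidal prime `P (inr 0)`.
[cite: MochizukiEtTh2009, Prop 5.3 (iv) p.325 (PDF p.99)] -/
theorem congr_swapNcsp_P_inr_zero : Primes.congr (reindex swapNcsp) (P (Sum.inr 0)) = P (Sum.inr 0) := by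
  rw [congr_reindex_P, swapNcsp_inr]

/-- `reindex (inl 0 inl 1)` MOVES the non-cuspidal prime `P (inl 0)` to `P (inl 1)`.
[cite: MochizukiEtTh2009, Prop 5.3 (iv) p.325 (PDF p.99)] -/
theorem congr_swapNcsp_P_inl_zero : Primes.congr (reindex swapNcsp) (P (Sum.inl 0)) = P (Sum.inl 1) := by
  rw [congr_reindex_P]
  exact congrArg P (Equiv.swap_apply_left _ _)

/-- `P (inl 0) ≠ P (inl 1)`: the component is genuinely moved. [cite: MochizukiFrdI2008, §0 p.12] -/
theorem P_inl_zero_ne_P_inl_one : P (Sum.inl 0) ≠ P (Sum.inl 1) :=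
  P_ne fun h => zero_ne_one (Sum.inl_injective h)

/-- **Prop. 5.3 (iv) FAILS at the toy datum** for `Ψ = 𝟭`, `ι = 𝟙`, `e = reindex (inl 0 inl 1)` (cuspidality of
primes IS preserved, `hc = cuspPreserved_swapNcsp`): the cusp `𝔞 = P (inr 0)` is fixed, so
`cspToNcsp (Ψ^Φ 𝔞) = cspToNcsp 𝔞 = P (inl 0)`, whereas `Ψ^Φ (cspToNcsp 𝔞) = Ψ^Φ (P (inl 0)) = P (inl 1)`.
[cite: MochizukiEtTh2009, Prop 5.3 (iv) p.325 (PDF p.99)] -/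
theorem not_preservesCspToNcsp_toy :
    ¬ PreservesCspToNcsp toyPrimeData (CategoryTheory.Equivalence.refl : TC ≌ TC) (Iso.refl Q)
      (reindex swapNcsp) cuspPreserved_swapNcsp := by
  intro h
  have h0 := h (P (Sum.inr 0)) (isCusp_P_inr 0)
  -- both sides, definitionally, in terms of the toy surjection `P (inr n) ↦ P (inl n)` and `Ψ^Φ = reindex swapNcsp`
  have h1 : P (Sum.inl (label (Primes.congr (reindex swapNcsp) (P (Sum.inr 0))))) =
      Primes.congr (reindex swapNcsp) (P (Sum.inl (label (P (Sum.inr 0))))) := h0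
  rw [congr_swapNcsp_P_inr_zero, label_P_inr, congr_swapNcsp_P_inl_zero] at h1
  exact P_inl_zero_ne_P_inl_one h1

/-- **F-0560: the universal closure of `FrobenioidThetaDivisors.PreservesCspToNcsp` is FALSE** — over ALL its binders
`(C, D, 𝔉, 𝔓, Ψ, ι, e, hc)` at level `0` (UNCONDITIONAL: the configuration of abc-iut-f-004's
`not_forall_preservesCspToNcsp_of_config` is realised by the in-tree toy datum).  R5: the row is an assumption about
NAMED §5 data, never a theorem of the interface.  [cite: MochizukiEtTh2009, Prop 5.3 (iv) p.325 (PDF p.99)] -/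
theorem not_forall_preservesCspToNcsp :
    ¬ ∀ (C : Type) [Category.{0} C] (D : Type) [Category.{0} D] (𝔉 : ThetaFrobenioid.{0} C D)
        (𝔓 : DivisorPrimeData 𝔉) (Ψ : C ≌ C) (ι : Ψ.functor.obj 𝔉.Acirc ≅ 𝔉.Acirc)
        (e : 𝔉.PhiAcirc ≃* 𝔉.pre.Mon (𝔉.base.obj (Ψ.functor.obj 𝔉.Acirc))) (hc : CuspPreserved 𝔓 Ψ ι e),
        Literature.AnabelianGeometry.EtaleTheta.FrobenioidThetaDivisors.PreservesCspToNcsp 𝔓 Ψ ι e hc :=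
  fun h => not_preservesCspToNcsp_toy (h TC TD toyThetaDiv toyPrimeData _ _ _ cuspPreserved_swapNcsp)

/-- **F-0560 schema census**: the universal closure of the row is FALSE, AND — by name — the instance form of record
HOLDS at the chain model for every chain automorphism `e = reindex (j ↦ εj + c)`, `ε = ±1`, `c ∈ ℤ` (abc-iut-f-128's
`Prop53Chain.preservesCspToNcsp_chain`): FACT-LIST class «universal-closure REFUTED; instance form PROVED».
[cite: MochizukiEtTh2009, Prop 5.3 (iv) p.325 (PDF p.99)] -/
theorem preservesCspToNcsp_schema_census (ε : ℤˣ) (c : ℤ) :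
    (¬ ∀ (C : Type) [Category.{0} C] (D : Type) [Category.{0} D] (𝔉 : ThetaFrobenioid.{0} C D)
        (𝔓 : DivisorPrimeData 𝔉) (Ψ : C ≌ C) (ι : Ψ.functor.obj 𝔉.Acirc ≅ 𝔉.Acirc)
        (e : 𝔉.PhiAcirc ≃* 𝔉.pre.Mon (𝔉.base.obj (Ψ.functor.obj 𝔉.Acirc))) (hc : CuspPreserved 𝔓 Ψ ι e),
        Literature.AnabelianGeometry.EtaleTheta.FrobenioidThetaDivisors.PreservesCspToNcsp 𝔓 Ψ ι e hc) ∧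
      Literature.AnabelianGeometry.EtaleTheta.FrobenioidThetaDivisors.PreservesCspToNcsp Prop53Chain.chainPrimeData
        Prop53Chain.Ψ₁ Prop53Chain.ι₁ (reindex (Prop53Chain.chainAut ε c)) (Prop53Chain.cuspPreserved_chain ε c) :=
  ⟨not_forall_preservesCspToNcsp, Prop53Chain.preservesCspToNcsp_chain ε c⟩

end Prop53Toy

end FrobenioidThetaDivisors

end Literature.AnabelianGeometry.EtaleTheta
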